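import Mathlib
import Summits.Ventures.HodgeRepro.Tier4.Common.AdelicDefs
import Summits.Ventures.HodgeRepro.Tier4.Common.MixedPlane
import Summits.Ventures.HodgeRepro.Tier4.Common.RowPlane

/-!
# Tier4/Common/RowTorus — the adelic torus of a row plane, block by block: every element of `torusT` of
`PlaneData.ofLinesRow q a b ε` is `blockDiag4 (x₀ + y₀ Ω) (x₁ + y₁ Ω)` with `x_j, y_j ∈ 𝔸_k` and
`N(x_j + y_j ω) = x_j² + t x_j y_j + n y_j² = 1` (plan-4's acceptance test (b) of S12722 at the adelic level)

Blind re-derivation cell `pub-hodge-repro`, Tier 4 (README §9–§10), seat t4-typer-2 (gen 2).  Target tree path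
`lean/Summits/Ventures/HodgeRepro/Tier4/Common/RowTorus.lean`.  Imports `AdelicDefs` (`GA`, `torusT`, `commutant`,
`adMat`), `MixedPlane` (`blockDiag4`, `omegaMat`, `lineGram`), `RowPlane` (`lineGramRow`, `PlaneData.ofLinesRow`,
`omegaMatR`, `lineGramRowR`, `commute_omegaMatR_iff`, `normForm_mul_lineGramRowR`).

CHAIN.  `blockDiag4R` is the block-diagonal matrix over any commutative ring (`adMat` of `blockDiag4` is it:
`adMat_blockDiag4`); a matrix commuting with `blockDiag4R 1 0` is block-diagonal (`exists_blockDiag4R_of_commute`);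
an element of `torusT` commutes with `P 0 = blockDiag4 1 0`, so it is `blockDiag4R A D`; it commutes with
`Ω = blockDiag4 ω ω`, so `A`, `D` commute with `ω` and are `x • 1 + y • ω` (`commute_omegaMatR_iff`); it preserves
the row Gram `blockDiag4 G_a (ε • G_b)`, so `A G_a Aᵀ = G_a`, i.e. `N(x₀ + y₀ ω) • G_a = G_a` (`normForm_mul_lineGramRowR`)
and `N = 1` because the `(1, 1)` entry `2a` of `G_a` is a unit of `𝔸_k` (`a ≠ 0` in `k`).  **`exists_block_of_mem_torusT_ofLinesRow`**
is the statement; at an infinite place `w` the component of `N = 1` says that the local torus is the norm-one circle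
`|x + y ω_w|² = 1` of `ℂ` — the reading plan-4's K-type clauses need and crit-2's O-L4-2 instance lacked.

Nothing here says anything about the status of the Hodge conjecture for CM abelian varieties, which is NOT proved
(HC_CM is NOT proved by anyone in this repository).
-/

set_option autoImplicit false

noncomputable section

namespace Summit.Ventures.HodgeRepro.Tier4.Common

open Matrix NumberField
open scoped NumberField

section BlockRing

variable {R : Type} [CommRing R]

/-- Reindexing `Fin 2 ⊕ Fin 2 ≃ Fin 4` as an algebra equivalence of square matrices, over any commutative ring
(`re4` of `MixedPlane` for a field). -/
def re4R : Matrix (Fin 2 ⊕ Fin 2) (Fin 2 ⊕ Fin 2) R ≃ₐ[R] Matrix (Fin 4) (Fin 4) R :=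
  Matrix.reindexAlgEquiv R R finSumFinEquiv

/-- A block-diagonal `4 × 4` matrix from two `2 × 2` blocks, over any commutative ring. -/
def blockDiag4R (A D : Matrix (Fin 2) (Fin 2) R) : Matrix (Fin 4) (Fin 4) R := re4R (fromBlocks A 0 0 D)

/-- Products of block-diagonal matrices are block-diagonal. -/
theorem blockDiag4R_mul (A D A' D' : Matrix (Fin 2) (Fin 2) R) :
    blockDiag4R A D * blockDiag4R A' D' = blockDiag4R (A * A') (D * D') := by
  simp only [blockDiag4R, ← map_mul, fromBlocks_multiply, Matrix.mul_zero, Matrix.zero_mul, add_zero, zero_add]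

/-- The transpose of a block-diagonal matrix. -/
theorem blockDiag4R_transpose (A D : Matrix (Fin 2) (Fin 2) R) : (blockDiag4R A D)ᵀ = blockDiag4R Aᵀ Dᵀ := by
  simp only [blockDiag4R, re4R, coe_reindexAlgEquiv, transpose_reindex, fromBlocks_transpose, transpose_zero]

/-- The block-diagonal matrix with identity blocks is the identity. -/
theorem blockDiag4R_one : blockDiag4R (1 : Matrix (Fin 2) (Fin 2) R) 1 = 1 := by
  simp only [blockDiag4R, fromBlocks_one, map_one]

/-- Block-diagonal matrices with the same blocks are equal, and conversely. -/
theorem blockDiag4R_inj {A D A' D' : Matrix (Fin 2) (Fin 2) R} :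
    blockDiag4R A D = blockDiag4R A' D' ↔ A = A' ∧ D = D' := by
  constructor
  · intro h
    have h' := (re4R (R := R)).injective h
    obtain ⟨h1, -, -, h2⟩ := fromBlocks_inj.1 h'
    exact ⟨h1, h2⟩
  · rintro ⟨rfl, rfl⟩
    rfl

/-- **A matrix commuting with `blockDiag4R 1 0` is block-diagonal.** -/
theorem exists_blockDiag4R_of_commute (M : Matrix (Fin 4) (Fin 4) R)
    (h : M * blockDiag4R 1 0 = blockDiag4R 1 0 * M) : ∃ A D : Matrix (Fin 2) (Fin 2) R, M = blockDiag4R A D := by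
  obtain ⟨N, hM⟩ : ∃ N : Matrix (Fin 2 ⊕ Fin 2) (Fin 2 ⊕ Fin 2) R, M = re4R N :=
    ⟨(re4R (R := R)).symm M, (AlgEquiv.apply_symm_apply _ _).symm⟩
  have hN : N = fromBlocks N.toBlocks₁₁ N.toBlocks₁₂ N.toBlocks₂₁ N.toBlocks₂₂ := (fromBlocks_toBlocks N).symm
  have h' : N * fromBlocks 1 0 0 0 = fromBlocks 1 0 0 0 * N := by
    apply (re4R (R := R)).injective
    rw [map_mul, map_mul, ← hM]
    exact h
  rw [hN, fromBlocks_multiply, fromBlocks_multiply] at h'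
  simp only [Matrix.mul_one, Matrix.mul_zero, Matrix.one_mul, Matrix.zero_mul, add_zero] at h'
  obtain ⟨-, h12, h21, -⟩ := fromBlocks_inj.1 h'
  refine ⟨N.toBlocks₁₁, N.toBlocks₂₂, ?_⟩
  rw [hM, blockDiag4R]
  congr 1
  conv_lhs => rw [hN]
  rw [← h12, h21]

end BlockRing

section Transport

variable {k : Type} [Field k] [NumberField k]

/-- `adMat` of a block-diagonal matrix is the block-diagonal matrix of the mapped blocks. -/
theorem adMat_blockDiag4 (A D : Matrix (Fin 2) (Fin 2) k) :
    adMat k (blockDiag4 A D) = blockDiag4R (A.map (algebraMap k (Ad k))) (D.map (algebraMap k (Ad k))) := by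
  simp only [adMat, blockDiag4, blockDiag4R, re4, re4R, coe_reindexAlgEquiv, Matrix.reindex_apply]
  rw [← Matrix.submatrix_map, fromBlocks_map, Matrix.map_zero _ (map_zero _)]

/-- `adMat` of `blockDiag4 1 0`. -/
theorem adMat_blockDiag4_one_zero :
    adMat k (blockDiag4 (1 : Matrix (Fin 2) (Fin 2) k) 0) = blockDiag4R (1 : Matrix (Fin 2) (Fin 2) (Ad k)) 0 := by
  rw [adMat_blockDiag4, Matrix.map_one _ (map_zero _) (map_one _), Matrix.map_zero _ (map_zero _)]

end Transport

section Scalar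

variable {k : Type} [Field k] (q : QuadData k)

/-- `ε • lineGramRow q b = lineGramRow q (ε * b)`. -/
theorem smul_lineGramRow (b ε : k) : ε • lineGramRow q b = lineGramRow q (ε * b) := by
  simp only [lineGramRow, smul_smul]

end Scalar

section Torus

variable {k : Type} [Field k] [NumberField k] (q : QuadData k)

/-- The `(1, 1)` entry of `lineGramRowR t n a` is `a * 2`. -/
theorem lineGramRowR_apply_one_one {R : Type} [CommRing R] (t n a : R) : lineGramRowR t n a 1 1 = a * 2 := by
  simp [lineGramRowR]

/-- **The norm-one conclusion on a block**: if `(x • 1 + y • ω) G_r (x • 1 + y • ω)ᵀ = G_r` for the row Gram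
`G_r = lineGramRowR t n a'` with `a' * 2` a unit, then `x² + t x y + n y² = 1`. -/
theorem norm_eq_one_of_block {R : Type} [CommRing R] (t n a' x y : R) (ha : IsUnit (a' * 2))
    (h : (x • (1 : Matrix (Fin 2) (Fin 2) R) + y • omegaMatR t n) * lineGramRowR t n a' *
      (x • (1 : Matrix (Fin 2) (Fin 2) R) + y • omegaMatR t n)ᵀ = lineGramRowR t n a') :
    x ^ 2 + t * x * y + n * y ^ 2 = 1 := by
  rw [normForm_mul_lineGramRowR] at h
  have h11 := congrFun (congrFun h 1) 1
  rw [Matrix.smul_apply, lineGramRowR_apply_one_one, smul_eq_mul] at h11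
  apply ha.mul_left_injective
  show (x ^ 2 + t * x * y + n * y ^ 2) * (a' * 2) = 1 * (a' * 2)
  rw [h11, one_mul]

/-- **The adelic torus of a row plane, block by block.**  For `g ∈ torusT (ofLinesRow q a b ε)` (`a, b, ε ≠ 0`):
`g = blockDiag4 (x₀ • 1 + y₀ • ω) (x₁ • 1 + y₁ • ω)` with `x_j, y_j ∈ 𝔸_k` and `x_j² + t x_j y_j + n y_j² = 1` —
right multiplication by the norm-one adeles `x_j + y_j ω` of `E′` on the two lines. -/
theorem exists_block_of_mem_torusT_ofLinesRow (a b ε : k) (ha : a ≠ 0) (hb : b ≠ 0) (hε : ε ≠ 0)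
    (g : GA (PlaneData.ofLinesRow q a b ε)) (hg : g ∈ torusT (PlaneData.ofLinesRow q a b ε)) :
    ∃ x₀ y₀ x₁ y₁ : Ad k,
      GA.mat (PlaneData.ofLinesRow q a b ε) g =
        blockDiag4R (x₀ • (1 : Matrix (Fin 2) (Fin 2) (Ad k)) + y₀ • omegaMatR (algebraMap k (Ad k) q.t) (algebraMap k (Ad k) q.n))
          (x₁ • (1 : Matrix (Fin 2) (Fin 2) (Ad k)) + y₁ • omegaMatR (algebraMap k (Ad k) q.t) (algebraMap k (Ad k) q.n)) ∧
      x₀ ^ 2 + algebraMap k (Ad k) q.t * x₀ * y₀ + algebraMap k (Ad k) q.n * y₀ ^ 2 = 1 ∧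
      x₁ ^ 2 + algebraMap k (Ad k) q.t * x₁ * y₁ + algebraMap k (Ad k) q.n * y₁ ^ 2 = 1 := by
  -- (1) block-diagonal from the commutation with `P 0`
  have hP0 : (PlaneData.ofLinesRow q a b ε).P 0 = blockDiag4 1 0 := rfl
  have hc : GA.mat (PlaneData.ofLinesRow q a b ε) g * adMat k ((PlaneData.ofLinesRow q a b ε).P 0) =
      adMat k ((PlaneData.ofLinesRow q a b ε).P 0) * GA.mat (PlaneData.ofLinesRow q a b ε) g := hg.1
  rw [hP0, adMat_blockDiag4_one_zero] at hc
  obtain ⟨A, D, hAD⟩ := exists_blockDiag4R_of_commute _ hc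
  -- (2) the blocks commute with `ω`
  have hΩ : (PlaneData.ofLinesRow q a b ε).Ω = blockDiag4 (omegaMat q) (omegaMat q) := rfl
  have hcΩ : GA.mat (PlaneData.ofLinesRow q a b ε) g * adMat k (PlaneData.ofLinesRow q a b ε).Ω =
      adMat k (PlaneData.ofLinesRow q a b ε).Ω * GA.mat (PlaneData.ofLinesRow q a b ε) g :=
    ((mem_unitaryGroup (PlaneData.ofLinesRow q a b ε) _).1 g.2).1
  rw [hΩ, adMat_blockDiag4, omegaMat_map, hAD, blockDiag4R_mul, blockDiag4R_mul] at hcΩ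
  obtain ⟨hA, hD⟩ := blockDiag4R_inj.1 hcΩ
  obtain ⟨x₀, y₀, hA'⟩ : ∃ x y : Ad k, A = x • (1 : Matrix (Fin 2) (Fin 2) (Ad k)) +
      y • omegaMatR (algebraMap k (Ad k) q.t) (algebraMap k (Ad k) q.n) :=
    ⟨A 0 0, A 1 0, (commute_omegaMatR_iff _ _ A).1 hA⟩
  obtain ⟨x₁, y₁, hD'⟩ : ∃ x y : Ad k, D = x • (1 : Matrix (Fin 2) (Fin 2) (Ad k)) +
      y • omegaMatR (algebraMap k (Ad k) q.t) (algebraMap k (Ad k) q.n) :=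
    ⟨D 0 0, D 1 0, (commute_omegaMatR_iff _ _ D).1 hD⟩
  -- (3) the blocks preserve the row Grams
  have hB : (PlaneData.ofLinesRow q a b ε).B = blockDiag4 (lineGramRow q a) (lineGramRow q (ε * b)) := by
    show blockDiag4 (lineGramRow q a) (ε • lineGramRow q b) = _
    rw [smul_lineGramRow]
  have hcB : GA.mat (PlaneData.ofLinesRow q a b ε) g * adMat k (PlaneData.ofLinesRow q a b ε).B *
      (GA.mat (PlaneData.ofLinesRow q a b ε) g)ᵀ = adMat k (PlaneData.ofLinesRow q a b ε).B :=
    ((mem_unitaryGroup (PlaneData.ofLinesRow q a b ε) _).1 g.2).2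
  rw [hB, adMat_blockDiag4, lineGramRow_map, lineGramRow_map, hAD, blockDiag4R_transpose, blockDiag4R_mul,
    blockDiag4R_mul] at hcB
  obtain ⟨hGA, hGD⟩ := blockDiag4R_inj.1 hcB
  rw [hA'] at hGA
  rw [hD'] at hGD
  have hua : IsUnit (algebraMap k (Ad k) a * 2) := by
    have : algebraMap k (Ad k) (a * 2) = algebraMap k (Ad k) a * 2 := by rw [map_mul, map_ofNat]
    rw [← this]
    exact (isUnit_iff_ne_zero.2 (mul_ne_zero ha two_ne_zero)).map (algebraMap k (Ad k))
  have hub : IsUnit (algebraMap k (Ad k) (ε * b) * 2) := by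
    have : algebraMap k (Ad k) (ε * b * 2) = algebraMap k (Ad k) (ε * b) * 2 := by rw [map_mul, map_ofNat]
    rw [← this]
    exact (isUnit_iff_ne_zero.2 (mul_ne_zero (mul_ne_zero hε hb) two_ne_zero)).map (algebraMap k (Ad k))
  refine ⟨x₀, y₀, x₁, y₁, ?_, ?_, ?_⟩
  · rw [hAD, hA', hD']
  · exact norm_eq_one_of_block _ _ _ _ _ hua hGA
  · exact norm_eq_one_of_block _ _ _ _ _ hub hGD

end Torus

/-! ## v0.2 (append): the converse — every pair of norm-one blocks IS an element of the torus

`blockOf t n x y := x • 1 + y • ω` is invertible when `N = x² + t x y + n y² = 1`, with inverse the conjugate block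
`blockOf t n (x + t y) (−y)` (`blockOf_mul_conj`); the block-diagonal matrix of two such blocks is a unit of
`M₄(𝔸_k)`, commutes with `Ω` and with the projectors, and preserves the row Gram (`normForm_mul_lineGramRowR` with
`N = 1`) — so it lies in `unitaryGroup (ofLinesRow q a b ε)` and in `torusT` (`mem_torusT_ofLinesRow_of_blocks`).
With `exists_block_of_mem_torusT_ofLinesRow` this is the equality `torusT (ofLinesRow q a b ε) = {two norm-one
adeles of E′}` on the kernel. -/

section Converse

variable {R : Type} [CommRing R]

/-- The block `x • 1 + y • ω` of right multiplication by `x + y ω`. -/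
def blockOf (t n x y : R) : Matrix (Fin 2) (Fin 2) R := x • (1 : Matrix (Fin 2) (Fin 2) R) + y • omegaMatR t n

/-- The block of `x + y ω` times the block of its conjugate `(x + t y) − y ω` is `N(x + y ω) • 1`. -/
theorem blockOf_mul_conj (t n x y : R) :
    blockOf t n x y * blockOf t n (x + t * y) (-y) = (x ^ 2 + t * x * y + n * y ^ 2) • (1 : Matrix (Fin 2) (Fin 2) R) := by
  ext i j
  fin_cases i <;> fin_cases j <;> simp [blockOf, omegaMatR, Matrix.mul_apply, Fin.sum_univ_two] <;> ring

/-- The conjugate block times the block is `N • 1` as well. -/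
theorem conj_mul_blockOf (t n x y : R) :
    blockOf t n (x + t * y) (-y) * blockOf t n x y = (x ^ 2 + t * x * y + n * y ^ 2) • (1 : Matrix (Fin 2) (Fin 2) R) := by
  ext i j
  fin_cases i <;> fin_cases j <;> simp [blockOf, omegaMatR, Matrix.mul_apply, Fin.sum_univ_two] <;> ring

/-- A block `x • 1 + y • ω` commutes with `ω`. -/
theorem blockOf_mul_omegaMatR (t n x y : R) : blockOf t n x y * omegaMatR t n = omegaMatR t n * blockOf t n x y := by
  simp only [blockOf, Matrix.add_mul, Matrix.mul_add, Matrix.smul_mul, Matrix.mul_smul, Matrix.one_mul, Matrix.mul_one]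

end Converse

section ConverseTorus

variable {k : Type} [Field k] [NumberField k] (q : QuadData k)

/-- The block-diagonal matrix of two norm-one blocks, as a unit of `M₄(𝔸_k)` (inverse = the conjugate blocks). -/
def torusUnit (x₀ y₀ x₁ y₁ : Ad k)
    (h₀ : x₀ ^ 2 + algebraMap k (Ad k) q.t * x₀ * y₀ + algebraMap k (Ad k) q.n * y₀ ^ 2 = 1)
    (h₁ : x₁ ^ 2 + algebraMap k (Ad k) q.t * x₁ * y₁ + algebraMap k (Ad k) q.n * y₁ ^ 2 = 1) : GL4 k where
  val := blockDiag4R (blockOf (algebraMap k (Ad k) q.t) (algebraMap k (Ad k) q.n) x₀ y₀)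
    (blockOf (algebraMap k (Ad k) q.t) (algebraMap k (Ad k) q.n) x₁ y₁)
  inv := blockDiag4R (blockOf (algebraMap k (Ad k) q.t) (algebraMap k (Ad k) q.n) (x₀ + algebraMap k (Ad k) q.t * y₀) (-y₀))
    (blockOf (algebraMap k (Ad k) q.t) (algebraMap k (Ad k) q.n) (x₁ + algebraMap k (Ad k) q.t * y₁) (-y₁))
  val_inv := by
    rw [blockDiag4R_mul, blockOf_mul_conj, blockOf_mul_conj, h₀, h₁, one_smul, blockDiag4R_one]
  inv_val := by
    rw [blockDiag4R_mul, conj_mul_blockOf, conj_mul_blockOf, h₀, h₁, one_smul, blockDiag4R_one]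

/-- **Every pair of norm-one adeles of `E′` gives an element of the torus of the row plane**: the unit
`torusUnit` lies in `unitaryGroup (ofLinesRow q a b ε)` and in `torusT`. -/
theorem mem_torusT_ofLinesRow_of_blocks (a b ε : k) (x₀ y₀ x₁ y₁ : Ad k)
    (h₀ : x₀ ^ 2 + algebraMap k (Ad k) q.t * x₀ * y₀ + algebraMap k (Ad k) q.n * y₀ ^ 2 = 1)
    (h₁ : x₁ ^ 2 + algebraMap k (Ad k) q.t * x₁ * y₁ + algebraMap k (Ad k) q.n * y₁ ^ 2 = 1) :
    ∃ hu : torusUnit q x₀ y₀ x₁ y₁ h₀ h₁ ∈ unitaryGroup (PlaneData.ofLinesRow q a b ε),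
      (⟨torusUnit q x₀ y₀ x₁ y₁ h₀ h₁, hu⟩ : GA (PlaneData.ofLinesRow q a b ε)) ∈ torusT (PlaneData.ofLinesRow q a b ε) := by
  have hΩ : (PlaneData.ofLinesRow q a b ε).Ω = blockDiag4 (omegaMat q) (omegaMat q) := rfl
  have hB : (PlaneData.ofLinesRow q a b ε).B = blockDiag4 (lineGramRow q a) (lineGramRow q (ε * b)) := by
    show blockDiag4 (lineGramRow q a) (ε • lineGramRow q b) = _
    rw [smul_lineGramRow]
  have hP0 : (PlaneData.ofLinesRow q a b ε).P 0 = blockDiag4 1 0 := rfl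
  have hP1 : (PlaneData.ofLinesRow q a b ε).P 1 = blockDiag4 0 1 := rfl
  have hval : ((torusUnit q x₀ y₀ x₁ y₁ h₀ h₁ : GL4 k) : M4 k) =
      blockDiag4R (blockOf (algebraMap k (Ad k) q.t) (algebraMap k (Ad k) q.n) x₀ y₀)
        (blockOf (algebraMap k (Ad k) q.t) (algebraMap k (Ad k) q.n) x₁ y₁) := rfl
  have hu : torusUnit q x₀ y₀ x₁ y₁ h₀ h₁ ∈ unitaryGroup (PlaneData.ofLinesRow q a b ε) := by
    rw [mem_unitaryGroup, hval, hΩ, hB, adMat_blockDiag4, adMat_blockDiag4, omegaMat_map, lineGramRow_map,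
      lineGramRow_map, blockDiag4R_transpose, blockDiag4R_mul, blockDiag4R_mul, blockDiag4R_mul, blockDiag4R_mul,
      blockOf_mul_omegaMatR, blockOf_mul_omegaMatR]
    refine ⟨rfl, ?_⟩
    simp only [blockOf, normForm_mul_lineGramRowR, h₀, h₁, one_smul]
  refine ⟨hu, ?_, ?_⟩
  · show ((torusUnit q x₀ y₀ x₁ y₁ h₀ h₁ : GL4 k) : M4 k) * adMat k ((PlaneData.ofLinesRow q a b ε).P 0) =
      adMat k ((PlaneData.ofLinesRow q a b ε).P 0) * ((torusUnit q x₀ y₀ x₁ y₁ h₀ h₁ : GL4 k) : M4 k)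
    rw [hval, hP0, adMat_blockDiag4_one_zero, blockDiag4R_mul, blockDiag4R_mul, Matrix.mul_one, Matrix.one_mul,
      Matrix.mul_zero, Matrix.zero_mul]
  · show ((torusUnit q x₀ y₀ x₁ y₁ h₀ h₁ : GL4 k) : M4 k) * adMat k ((PlaneData.ofLinesRow q a b ε).P 1) =
      adMat k ((PlaneData.ofLinesRow q a b ε).P 1) * ((torusUnit q x₀ y₀ x₁ y₁ h₀ h₁ : GL4 k) : M4 k)
    rw [hval, hP1, adMat_blockDiag4, Matrix.map_one _ (map_zero _) (map_one _), Matrix.map_zero _ (map_zero _),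
      blockDiag4R_mul, blockDiag4R_mul, Matrix.mul_one, Matrix.one_mul, Matrix.mul_zero, Matrix.zero_mul]

end ConverseTorus

/-! ## v0.3 (append): the torus of a row plane is COMMUTATIVE, hence its left Haar measures are right invariant

Two blocks `x • 1 + y • ω`, `x′ • 1 + y′ • ω` commute (`blockOf_mul_comm`); by `exists_block_of_mem_torusT_ofLinesRow`
every element of `torusT (ofLinesRow q a b ε)` is block-diagonal with such blocks, so any two of them commute
(`torusT_ofLinesRow_comm`).  A left-invariant measure on a group in which all elements commute is right invariant
(`isMulRightInvariant_of_forall_comm`, generic) — this discharges the `[R.μT.IsMulRightInvariant]` binders of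
`CentralConsistency` on the row planes (`isMulRightInvariant_torusT_ofLinesRow`). -/

section Commutative

variable {R : Type} [CommRing R]

/-- Two blocks `x • 1 + y • ω` commute. -/
theorem blockOf_mul_comm (t n x y x' y' : R) :
    blockOf t n x y * blockOf t n x' y' = blockOf t n x' y' * blockOf t n x y := by
  ext i j
  fin_cases i <;> fin_cases j <;> simp [blockOf, omegaMatR, Matrix.mul_apply, Fin.sum_univ_two] <;> ring

end Commutative

section TorusComm

variable {k : Type} [Field k] [NumberField k] (q : QuadData k)

/-- **The torus of a row plane is commutative**: any two elements of `torusT (ofLinesRow q a b ε)` commute. -/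
theorem torusT_ofLinesRow_comm (a b ε : k) (ha : a ≠ 0) (hb : b ≠ 0) (hε : ε ≠ 0)
    (g h : GA (PlaneData.ofLinesRow q a b ε)) (hg : g ∈ torusT (PlaneData.ofLinesRow q a b ε))
    (hh : h ∈ torusT (PlaneData.ofLinesRow q a b ε)) : g * h = h * g := by
  obtain ⟨x₀, y₀, x₁, y₁, hgm, -, -⟩ := exists_block_of_mem_torusT_ofLinesRow q a b ε ha hb hε g hg
  obtain ⟨x₀', y₀', x₁', y₁', hhm, -, -⟩ := exists_block_of_mem_torusT_ofLinesRow q a b ε ha hb hε h hh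
  apply Subtype.ext
  apply Units.ext
  show GA.mat _ g * GA.mat _ h = GA.mat _ h * GA.mat _ g
  rw [hgm, hhm, blockDiag4R_mul, blockDiag4R_mul]
  congr 1
  · exact blockOf_mul_comm _ _ _ _ _ _
  · exact blockOf_mul_comm _ _ _ _ _ _

end TorusComm

section RightInvariant

open MeasureTheory

/-- **A left-invariant measure on a group whose elements all commute is right invariant** (right translation by `g` IS
left translation by `g`). -/
theorem isMulRightInvariant_of_forall_comm {G : Type} [Group G] [MeasurableSpace G] (μ : Measure G)
    [μ.IsMulLeftInvariant] (hcomm : ∀ a b : G, a * b = b * a) : μ.IsMulRightInvariant := by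
  refine ⟨fun g => ?_⟩
  have h : (fun x : G => x * g) = fun x => g * x := funext fun x => hcomm x g
  rw [h]
  exact Measure.IsMulLeftInvariant.map_mul_left_eq_self g

/-- **Left Haar measures on the torus of a row plane are right invariant.** -/
theorem isMulRightInvariant_torusT_ofLinesRow {k : Type} [Field k] [NumberField k] (q : QuadData k) (a b ε : k)
    (ha : a ≠ 0) (hb : b ≠ 0) (hε : ε ≠ 0) [MeasurableSpace (torusT (PlaneData.ofLinesRow q a b ε))]
    (μ : Measure (torusT (PlaneData.ofLinesRow q a b ε))) [μ.IsMulLeftInvariant] : μ.IsMulRightInvariant :=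
  isMulRightInvariant_of_forall_comm μ fun s t =>
    Subtype.ext (torusT_ofLinesRow_comm q a b ε ha hb hε s t s.2 t.2)

end RightInvariant

end Summit.Ventures.HodgeRepro.Tier4.Common

end
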